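import Summits.AnomalousDissipation.AnomalousDissipation.Theorems.SawtoothPulseCascadeK2RapidPressure

/-!
# K2″: the cross-stream toolkit on an H half-slot (twins of `…K2InjectionCrossStream`, `…K2CrossStreamIdentity`,
# `…K2RapidPressure` for the horizontal pulse)
(route `AnomalousDissipation/SawtoothPulseCascade`, crux K2″ = stmt-AnomalousDissipation-19696 `K2LinearisedCascadeGrowth`,
line `phase-cocycle`; helper, `--supports`)

On an H half-slot `[a, b] = [tStart j, tStart j + tHalf j]` the cascade carrier is the horizontal shear
`ū = (rateH j t · U_j(x₁), 0)` (`∂₀ū = 0`, `∂₁ū = c e₀`, `c = rateH j t · U_j′(x₁)`, `partialDeriv_field_of_mem_H`): the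
roles of the coordinates are swapped with respect to the V half-slot (cross-stream component `w₁`, streamwise `w₀`).
A phase of the cascade is an H half-slot followed by a V half-slot (stub B of `phase-cocycle` / the point transfer
inequality of `target_of_phaseTransferH_eight` act across both), so the three cross-stream statements are recorded for
the H half-slot as well:

* `crossStream_energy_le_of_mem_H`, `crossStream_energy_le_of_mem_H'` — lift-up / Orr algebraic growth: a bound
  `∫ (w(s) x)₁² ≤ M²` on the slot gives `∫‖w(t)‖² ≤ ((∫‖w(a)‖²)^{1/2} + Mγ)²`, resp. amplification `≤ (1 + C₀γ)²`;
* `hasDerivWithinAt_integral_crossStream_sq_of_mem_H` — the cross-stream energy `∫ w₁²` is production-free;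
* `laplacian_pressure_eq_of_mem_H` — rapid pressure `Δq = −2 (rateH j t · U_j′(x₁)) (∂₀w)₁`.
-/

-- `Summit.<Summit>.<Problem>` is the tree's mandated summit-side namespace (CONVENTIONS §2); for this
-- single-conjunct summit the two coincide, so the duplicate is deliberate (lakefile: off for `Summits`).
set_option linter.dupNamespace false

noncomputable section

namespace Summit.AnomalousDissipation.AnomalousDissipation.Theorems.SawtoothPulseCascade.K2Classical

open Set MeasureTheory
open Literature.Analysis Literature.Analysis.FunctionSpaces Literature.Analysis.FluidPDE
open Literature.Analysis.FluidPDE.SawtoothCascade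
open Literature.Analysis.FluidPDE.SawtoothCascade.CascadeParams

/-- `tStart j < tStart j + tHalf j`. -/
private theorem tStart_lt_tMid (j : ℕ) : tStart j < tStart j + tHalf j := by linarith [tHalf_pos j]

/-- On an H half-slot the cascade field has no vertical component to first order: `(∂ᵢū(t, x))₁ = 0` for `i = 0, 1`.
[cite: ElgindiLissMattingly2025, §1 (u_α = H_α(x₂) e₁ on its half period)] -/
theorem partialDeriv_field_apply_one_of_mem_H (P : CascadeParams) {j : ℕ} {t : ℝ}
    (ht : t ∈ Icc (tStart j) (tStart j + tHalf j)) (x : UnitAddTorus (Fin 2)) :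
    ∀ i : Fin 2, Torus.partialDeriv i (P.field t) x 1 = 0 := by
  refine Fin.forall_fin_two.2 ⟨?_, ?_⟩
  · rw [(P.partialDeriv_field_of_mem_H ht x).1]
    simp
  · rw [(P.partialDeriv_field_of_mem_H ht x).2]
    simp

section HSlot

variable (P : CascadeParams) {j : ℕ} {ν : ℝ}
  {w : ℝ → UnitAddTorus (Fin 2) → EuclideanSpace ℝ (Fin 2)} {q : ℝ → UnitAddTorus (Fin 2) → ℝ}

/-- **Cross-stream control of the energy on an H half-slot** `[a, b] = [tStart j, tStart j + tHalf j]` (field jointly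
smooth there, `γ ≥ 0`, `δ j > 0`, `ν ≥ 0`; the horizontal shear `(rateH j t · U_j(x₁), 0)`, `|U_j′| ≤ 1`, strain `γ`): a
smooth linearised solution `(w, q)` with `∫ (w(s) x)₁² ≤ M²` on the slot (`M ≥ 0`) obeys
`∫ ‖w(t)‖² ≤ ((∫ ‖w(a)‖²)^{1/2} + Mγ)²` on the slot.
[cite: EllingsenPalm1975, eq. (5)–(7) (algebraic growth driven by the cross-stream velocity); ElgindiLissMattingly2025, §1 and Rmk. 1.4 (pulsed shear of strain α)] -/
theorem crossStream_energy_le_of_mem_H (hγ : 0 ≤ P.γ) (hδ : 0 < P.δ j) (hν : 0 ≤ ν)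
    (hu : Torus.IsSmoothSpaceTimeOn (Icc (tStart j) (tStart j + tHalf j)) P.field)
    (hw : Torus.IsSmoothSpaceTimeOn (Icc (tStart j) (tStart j + tHalf j)) w)
    (hq : Torus.IsSmoothSpaceTimeOn (Icc (tStart j) (tStart j + tHalf j)) q)
    (hwdiv : ∀ t ∈ Icc (tStart j) (tStart j + tHalf j), Torus.IsDivFree (w t))
    (hlin : ∀ t ∈ Icc (tStart j) (tStart j + tHalf j), ∀ x,
      Torus.timeDerivWithin (Icc (tStart j) (tStart j + tHalf j)) w t x +
        Torus.convect (P.field t) (w t) x + Torus.convect (w t) (P.field t) x =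
          ν • Torus.laplacian (w t) x - Torus.gradient (q t) x)
    {M : ℝ} (hM0 : 0 ≤ M) (hM : ∀ s ∈ Icc (tStart j) (tStart j + tHalf j), ∫ x, (w s x 1) ^ 2 ≤ M ^ 2)
    {t : ℝ} (ht : t ∈ Icc (tStart j) (tStart j + tHalf j)) :
    ∫ x, ‖w t x‖ ^ 2 ≤ (Real.sqrt (∫ x, ‖w (tStart j) x‖ ^ 2) + M * P.γ) ^ 2 := by
  have h1 := linearisedNS_integral_norm_sq_le_sq_of_shear_of_crossStream hν hu
    (fun s hs => P.isDivFree_field_of_mem_H hs) hw hq hwdiv hlin (k := (1 : Fin 2)) (m := 0)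
    (c := fun s x => P.rateH j s * deriv (P.U j) (Torus.repr x 1)) (r := P.rateH j)
    (fun s hs x i hi => by
      obtain rfl : i = 0 := by omega
      exact (P.partialDeriv_field_of_mem_H hs x).1)
    (fun s hs x => (P.partialDeriv_field_of_mem_H hs x).2)
    (fun s hs x => by
      rw [abs_mul, abs_of_nonneg (P.rateH_nonneg hγ j s)]
      calc P.rateH j s * |deriv (P.U j) (Torus.repr x 1)| ≤ P.rateH j s * 1 := by
            gcongr
            · exact P.rateH_nonneg hγ j s
            · exact P.abs_deriv_U_le_one hδ _
        _ = P.rateH j s := mul_one _)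
    (P.continuous_rateH j) hM0 hM ht
  refine h1.trans ?_
  have hIγ := P.integral_rateH_le hγ ht
  have hs0 : 0 ≤ Real.sqrt (∫ x, ‖w (tStart j) x‖ ^ 2) := Real.sqrt_nonneg _
  have hI0 : 0 ≤ ∫ s in (tStart j)..t, P.rateH j s :=
    intervalIntegral.integral_nonneg ht.1 fun s _ => P.rateH_nonneg hγ j s
  have hMI : M * (∫ s in (tStart j)..t, P.rateH j s) ≤ M * P.γ := mul_le_mul_of_nonneg_left hIγ hM0
  exact pow_le_pow_left₀ (by positivity) (by linarith) 2

/-- **Cross-stream control of the energy on an H half-slot, relative form**: with `∫ (w(s) x)₁² ≤ C₀² ∫ ‖w(a)‖²` on the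
slot (`C₀ ≥ 0`), `∫ ‖w(t)‖² ≤ (1 + C₀γ)² ∫ ‖w(a)‖²` there.
[cite: EllingsenPalm1975, eq. (5)–(7) (algebraic growth driven by the cross-stream velocity); ElgindiLissMattingly2025, §1 and Rmk. 1.4 (pulsed shear of strain α)] -/
theorem crossStream_energy_le_of_mem_H' (hγ : 0 ≤ P.γ) (hδ : 0 < P.δ j) (hν : 0 ≤ ν)
    (hu : Torus.IsSmoothSpaceTimeOn (Icc (tStart j) (tStart j + tHalf j)) P.field)
    (hw : Torus.IsSmoothSpaceTimeOn (Icc (tStart j) (tStart j + tHalf j)) w)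
    (hq : Torus.IsSmoothSpaceTimeOn (Icc (tStart j) (tStart j + tHalf j)) q)
    (hwdiv : ∀ t ∈ Icc (tStart j) (tStart j + tHalf j), Torus.IsDivFree (w t))
    (hlin : ∀ t ∈ Icc (tStart j) (tStart j + tHalf j), ∀ x,
      Torus.timeDerivWithin (Icc (tStart j) (tStart j + tHalf j)) w t x +
        Torus.convect (P.field t) (w t) x + Torus.convect (w t) (P.field t) x =
          ν • Torus.laplacian (w t) x - Torus.gradient (q t) x)
    {C₀ : ℝ} (hC0 : 0 ≤ C₀)
    (hM : ∀ s ∈ Icc (tStart j) (tStart j + tHalf j),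
      ∫ x, (w s x 1) ^ 2 ≤ C₀ ^ 2 * ∫ x, ‖w (tStart j) x‖ ^ 2)
    {t : ℝ} (ht : t ∈ Icc (tStart j) (tStart j + tHalf j)) :
    ∫ x, ‖w t x‖ ^ 2 ≤ (1 + C₀ * P.γ) ^ 2 * ∫ x, ‖w (tStart j) x‖ ^ 2 := by
  set E₀ : ℝ := ∫ x, ‖w (tStart j) x‖ ^ 2 with hE₀
  have hE0 : 0 ≤ E₀ := integral_nonneg fun x => sq_nonneg _
  have hM' : ∀ s ∈ Icc (tStart j) (tStart j + tHalf j), ∫ x, (w s x 1) ^ 2 ≤ (C₀ * Real.sqrt E₀) ^ 2 := fun s hs => by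
    rw [mul_pow, Real.sq_sqrt hE0]
    exact hM s hs
  have h := crossStream_energy_le_of_mem_H P hγ hδ hν hu hw hq hwdiv hlin (by positivity) hM' ht
  calc ∫ x, ‖w t x‖ ^ 2 ≤ (Real.sqrt E₀ + C₀ * Real.sqrt E₀ * P.γ) ^ 2 := h
    _ = (1 + C₀ * P.γ) ^ 2 * Real.sqrt E₀ ^ 2 := by ring
    _ = (1 + C₀ * P.γ) ^ 2 * E₀ := by rw [Real.sq_sqrt hE0]

/-- **Cross-stream energy identity on an H half-slot**: `d/dt ∫ (w t x)₁² = 2 ∫ (w t x)₁ (νΔw − ∇q)(x)₁` within the slot —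
the vertical (= cross-stream) energy is production-free.
[cite: ConstantinFoiasNSE1988, Ch. 14 (14.3)–(14.4); ElgindiLissMattingly2025, §1 and Rmk. 1.4 (pulsed shear)] -/
theorem hasDerivWithinAt_integral_crossStream_sq_of_mem_H
    (hu : Torus.IsSmoothSpaceTimeOn (Icc (tStart j) (tStart j + tHalf j)) P.field)
    (hw : Torus.IsSmoothSpaceTimeOn (Icc (tStart j) (tStart j + tHalf j)) w)
    (hq : Torus.IsSmoothSpaceTimeOn (Icc (tStart j) (tStart j + tHalf j)) q)
    (hlin : ∀ t ∈ Icc (tStart j) (tStart j + tHalf j), ∀ x,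
      Torus.timeDerivWithin (Icc (tStart j) (tStart j + tHalf j)) w t x +
        Torus.convect (P.field t) (w t) x + Torus.convect (w t) (P.field t) x =
          ν • Torus.laplacian (w t) x - Torus.gradient (q t) x)
    {t : ℝ} (ht : t ∈ Icc (tStart j) (tStart j + tHalf j)) :
    HasDerivWithinAt (fun s => ∫ x, (w s x 1) ^ 2)
      (2 * ∫ x, w t x 1 * (ν • Torus.laplacian (w t) x - Torus.gradient (q t) x) 1)
      (Icc (tStart j) (tStart j + tHalf j)) t :=
  hasDerivWithinAt_integral_crossStream_sq hu (fun _ hs => P.isDivFree_field_of_mem_H hs) hw hq hlin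
    (tStart_lt_tMid j) (fun _ hs x i => partialDeriv_field_apply_one_of_mem_H P hs x i) ht

/-- **Rapid pressure on an H half-slot**: `Δq(t, x) = −2 (rateH j t · U_j′(x₁)) (∂₀w(t, x))₁`.
[cite: MajdaBertozziCUP2002, §1.8 (1.83) (pressure Poisson equation); ElgindiLissMattingly2025, §1 (u_α = H_α(x₂) e₁ on its half period)] -/
theorem laplacian_pressure_eq_of_mem_H
    (hu : Torus.IsSmoothSpaceTimeOn (Icc (tStart j) (tStart j + tHalf j)) P.field)
    (hw : Torus.IsSmoothSpaceTimeOn (Icc (tStart j) (tStart j + tHalf j)) w)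
    (hq : Torus.IsSmoothSpaceTimeOn (Icc (tStart j) (tStart j + tHalf j)) q)
    (hwdiv : ∀ t ∈ Icc (tStart j) (tStart j + tHalf j), Torus.IsDivFree (w t))
    (hlin : ∀ t ∈ Icc (tStart j) (tStart j + tHalf j), ∀ x,
      Torus.timeDerivWithin (Icc (tStart j) (tStart j + tHalf j)) w t x +
        Torus.convect (P.field t) (w t) x + Torus.convect (w t) (P.field t) x =
          ν • Torus.laplacian (w t) x - Torus.gradient (q t) x)
    {t : ℝ} (ht : t ∈ Icc (tStart j) (tStart j + tHalf j)) (x : UnitAddTorus (Fin 2)) :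
    Torus.laplacian (q t) x =
      -(2 * (P.rateH j t * deriv (P.U j) (Torus.repr x 1) * Torus.partialDeriv 0 (w t) x 1)) := by
  rw [laplacian_pressure_eq hu (fun _ hs => P.isDivFree_field_of_mem_H hs) hw hq hwdiv hlin (tStart_lt_tMid j) ht x,
    Fin.sum_univ_two, Fin.sum_univ_two, Fin.sum_univ_two, (P.partialDeriv_field_of_mem_H ht x).1,
    (P.partialDeriv_field_of_mem_H ht x).2]
  simp

end HSlot

end Summit.AnomalousDissipation.AnomalousDissipation.Theorems.SawtoothPulseCascade.K2Classical

end
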